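import Literature.NumberTheory.Automorphic.SmoothInduction
import Literature.NumberTheory.Automorphic.CompactOpenAveraging
import Literature.NumberTheory.Automorphic.JacquetModule
import HarnessLib

/-!
# The coinvariants of `C_c^∞(N, W)`: `dim H₀(N, C_c^∞(N, W)) ≤ dim W` for an `l`-group `N`

Topic `NumberTheory/Automorphic`; namespace `Representation`.  Two definitions WITH BODIES (`compactlySupported`,
`indicatorSection`) and theorems; no named fact, no `sorry`, no instance, no notation.

Let `N` be a topological group which is the union of its compact open subgroups (★ `IsLimitOfCompactOpen N`,
`JacquetModule`; e.g. the unipotent radical of a parabolic of a reductive `p`-adic group), `k` a field of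
characteristic `0` and `W` a `k`-module.  The smooth functions `N → W` with the RIGHT translation action
`(g·f)(x) = f(x g)` are the tree's ★ `Representation.SmoothInd (⊥ : Subgroup N) 𝟙_W` (`SmoothInduction`, induction from
the trivial subgroup); the compactly supported ones form the subrepresentation `compactlySupported` = `C_c^∞(N, W)`.

**Theorem** (`exists_eq_mk_indicatorSection`, `finrank_coinvariants_compactlySupported_le`): for every compact open
subgroup `K₀ ≤ N`, every class of the `N`-coinvariants `C_c^∞(N, W)_N` is the class of an indicator section
`1_{K₀} ⊗ w` (`indicatorSection K₀ w : x ↦ 1_{K₀}(x) w`); hence `C_c^∞(N, W)_N` is a quotient of `W` —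
finite-dimensional with `finrank ≤ finrank W` when `W` is.  (With a Haar measure the map is `f ↦ ∫_N f`, an
isomorphism `C_c^∞(N, W)_N ≅ W`; only the upper bound is proved here, measure-free.)

Proof (finite sums over transversals, as in ★ `CompactOpenAveraging` ∕ ★ `JacquetModuleExactProofs`).
(1) `1_U ⊗ w = ∑_{r ∈ R} r · (1_V ⊗ w)` for an open subgroup `V` of a compact open subgroup `U` and a left transversal
`R` of `U ∕ V` (★ `exists_isLeftTransversal`; the right cosets `V r⁻¹`, `r ∈ R`, tile `U`), so `[1_U ⊗ w] = |R| • [1_V ⊗ w]`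
(`mk_indicatorSection_eq_card_smul`); with `V := U ∩ K₀` this puts `[1_U ⊗ w]` in `{[1_{K₀} ⊗ w′]}` (`|R| ≠ 0` in
characteristic `0`; `mk_indicatorSection_mem_range`).  (2) A compactly supported smooth `φ` is constant on the left cosets
`y S` of `S := K₀ ∩ Stab(φ)` (compact open); finitely many of them cover its support, and `1_{yS} ⊗ w = y⁻¹ · (1_{ySy⁻¹} ⊗ w)`
(`indicatorSection_conj`), so `[φ] = ∑ [1_{y S y⁻¹} ⊗ φ(y)]` lies in that range too (`exists_eq_mk_indicatorSection`).

This is the «open-orbit term without Haar measure» device of ★ `OpenCellCoinvariants` (`mk_mem_span_range_mk_cellSection`)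
isolated on the group `N` itself, for use in geometric-lemma computations on groups other than `GL_n` (cell
`hodgecm-mathlib`, F0∕P3 node N1 `U3PrincipalSeriesJacquetFiltration`: the open-cell part of `r_B i_G(χ)` for `U(3)`
injects into `C_c^∞(N, ℂ)_N` by ★ `jacquetMap_injective`).

## References

* I. N. Bernstein, A. V. Zelevinsky, *Representations of the group `GL(n, F)` where `F` is a non-archimedean local
  field*, Russian Math. Surveys 31:3 (1976), §1.18–§1.19 (Haar measure on an `l`-group as the unique invariant
  distribution), §2.30–§2.35. [BernsteinZelevinsky1976]
* I. N. Bernstein, A. V. Zelevinsky, *Induced representations of reductive `p`-adic groups I*, Ann. Sci. ÉNS 10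
  (1977), Prop. 1.9 (a), Thm. 5.2 (the open orbit of the geometric lemma). [BernsteinZelevinsky1977]
* D. Bump, *Automorphic Forms and Representations* (1997), Prop. 4.4.1–4.4.2. [Bump1997]
-/

set_option autoImplicit false

noncomputable section

open scoped BigOperators Pointwise
open Literature.NumberTheory.Automorphic

namespace Representation

section CompactlySupported

variable {k : Type*} [Field k] {N : Type*} [Group N] [TopologicalSpace N] [IsTopologicalGroup N]
  {W : Type*} [AddCommGroup W] [Module k W]

/-! ## §1 `C_c^∞(N, W)` as a subrepresentation of `C^∞(N, W) = Ind_{1}^N 𝟙_W` -/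

/-- **`C_c^∞(N, W)`**: the smooth (= right-uniformly locally constant) functions `N → W` vanishing off a compact set,
a subrepresentation of `C^∞(N, W) = Ind_{1}^N 𝟙_W` (★ `smoothIndRep ⊥ 𝟙`) under right translation — the right
translate of a function supported in `C` is supported in `C g⁻¹`. [cite: BernsteinZelevinsky1976, §2.22] -/
def compactlySupported (k N W : Type*) [Field k] [Group N] [TopologicalSpace N] [IsTopologicalGroup N]
    [AddCommGroup W] [Module k W] :
    Subrepresentation (smoothIndRep (⊥ : Subgroup N) (Representation.trivial k (⊥ : Subgroup N) W)) where
  toSubmodule :=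
    { carrier := {f | ∃ C : Set N, IsCompact C ∧ ∀ x ∉ C, f.toFun x = 0}
      zero_mem' := ⟨∅, isCompact_empty, fun x _ => by
        have h := SmoothInd.toFun_smul (H := (⊥ : Subgroup N)) (σ := Representation.trivial k _ W) (0 : k) 0
        rw [zero_smul, zero_smul] at h
        rw [h, Pi.zero_apply]⟩
      add_mem' := by
        rintro f g ⟨C, hC, hf⟩ ⟨D, hD, hg⟩
        refine ⟨C ∪ D, hC.union hD, fun x hx => ?_⟩
        rw [Set.mem_union, not_or] at hx
        rw [SmoothInd.toFun_add, Pi.add_apply, hf x hx.1, hg x hx.2, add_zero]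
      smul_mem' := by
        rintro c f ⟨C, hC, hf⟩
        exact ⟨C, hC, fun x hx => by rw [SmoothInd.toFun_smul, Pi.smul_apply, hf x hx, smul_zero]⟩ }
  apply_mem_toSubmodule g := by
    rintro f ⟨C, hC, hf⟩
    refine ⟨(· * g⁻¹) '' C, hC.image (continuous_id.mul continuous_const), fun x hx => ?_⟩
    rw [toFun_smoothIndRep_apply]
    refine hf (x * g) fun hxg => hx ⟨x * g, hxg, ?_⟩
    simp only [mul_inv_cancel_right]

/-- Membership in `C_c^∞(N, W)` (the Schwartz space `S(N)` of locally constant compactly supported functions, `W`-valued). [cite: BernsteinZelevinsky1976, §1.1–§1.3] -/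
theorem mem_compactlySupported_iff
    (f : SmoothInd (⊥ : Subgroup N) (Representation.trivial k (⊥ : Subgroup N) W)) :
    f ∈ compactlySupported k N W ↔ ∃ C : Set N, IsCompact C ∧ ∀ x ∉ C, f.toFun x = 0 :=
  Iff.rfl

/-! ## §2 Indicator sections `1_U ⊗ w` of open subgroups -/

/-- A smooth function on `N` is constant on the left cosets of its stabiliser: `f(x g) = f(x)` for `g ∈ Stab(f)`.
[cite: BernsteinZelevinsky1976, §1.1–§1.3] -/
theorem SmoothInd.toFun_mul_of_mem_stabilizer
    {f : SmoothInd (⊥ : Subgroup N) (Representation.trivial k (⊥ : Subgroup N) W)} {g : N}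
    (hg : g ∈ (smoothIndRep (⊥ : Subgroup N) (Representation.trivial k (⊥ : Subgroup N) W)).stabilizerSubgroup f) (x : N) :
    f.toFun (x * g) = f.toFun x := by
  rw [mem_stabilizerSubgroup] at hg
  have h := congrArg (fun φ : SmoothInd (⊥ : Subgroup N) (Representation.trivial k (⊥ : Subgroup N) W) => φ.toFun x) hg
  simpa only [toFun_smoothIndRep_apply] using h

/-- **The indicator section `1_U ⊗ w`** of an OPEN subgroup `U ≤ N`: the function `x ↦ 1_U(x) w`, right-`U`-invariant
hence smooth; an element of `C^∞(N, W)`. [cite: BernsteinZelevinsky1976, §2.22] -/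
def indicatorSection (U : Subgroup N) (hU : IsOpen (U : Set N)) (w : W) :
    SmoothInd (⊥ : Subgroup N) (Representation.trivial k (⊥ : Subgroup N) W) := by
  refine (⟨⟨(U : Set N).indicator (fun _ => w), ?_⟩, ?_⟩ :
    ↥(smoothInd (⊥ : Subgroup N) (Representation.trivial k (⊥ : Subgroup N) W)).toSubmodule)
  · rw [mem_indFun_iff]
    intro h g
    rw [Subsingleton.elim h 1, Subgroup.coe_one, one_mul, map_one, Module.End.one_apply]
  · refine (indFun (⊥ : Subgroup N) (Representation.trivial k (⊥ : Subgroup N) W)).isSmoothVector_of_le hU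
      fun u hu => ?_
    rw [mem_stabilizerSubgroup]
    refine Subtype.ext (funext fun x => ?_)
    rw [indFun_apply_apply]
    change (U : Set N).indicator (fun _ => w) (x * u) = (U : Set N).indicator (fun _ => w) x
    by_cases hx : x ∈ U
    · rw [Set.indicator_of_mem (show x * u ∈ (U : Set N) from U.mul_mem hx hu), Set.indicator_of_mem (show x ∈ (U : Set N) from hx)]
    · have hxu : x * u ∉ (U : Set N) := fun h => hx (by simpa using U.mul_mem h (U.inv_mem hu))
      rw [Set.indicator_of_notMem hxu, Set.indicator_of_notMem (show x ∉ (U : Set N) from hx)]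

/-- Values of the indicator section: `(1_U ⊗ w)(x) = 1_U(x) w`. [cite: BernsteinZelevinsky1976, §1.1–§1.3] -/
theorem toFun_indicatorSection (U : Subgroup N) (hU : IsOpen (U : Set N)) (w : W) (x : N) :
    (indicatorSection (k := k) U hU w).toFun x = (U : Set N).indicator (fun _ => w) x :=
  rfl

/-- Values inside `U`: `(1_U ⊗ w)(x) = w`. [cite: BernsteinZelevinsky1976, §1.1–§1.3] -/
theorem toFun_indicatorSection_of_mem (U : Subgroup N) (hU : IsOpen (U : Set N)) (w : W) {x : N} (hx : x ∈ U) :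
    (indicatorSection (k := k) U hU w).toFun x = w := by
  rw [toFun_indicatorSection, Set.indicator_of_mem (show x ∈ (U : Set N) from hx)]

/-- Values outside `U`: `(1_U ⊗ w)(x) = 0`. [cite: BernsteinZelevinsky1976, §1.1–§1.3] -/
theorem toFun_indicatorSection_of_notMem (U : Subgroup N) (hU : IsOpen (U : Set N)) (w : W) {x : N} (hx : x ∉ U) :
    (indicatorSection (k := k) U hU w).toFun x = 0 := by
  rw [toFun_indicatorSection, Set.indicator_of_notMem (show x ∉ (U : Set N) from hx)]

/-- The indicator section is additive in `w`. [cite: BernsteinZelevinsky1976, §1.1–§1.3] -/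
theorem indicatorSection_add (U : Subgroup N) (hU : IsOpen (U : Set N)) (w w' : W) :
    indicatorSection (k := k) U hU (w + w') = indicatorSection U hU w + indicatorSection U hU w' := by
  apply SmoothInd.ext
  funext x
  rw [SmoothInd.toFun_add, Pi.add_apply, toFun_indicatorSection, toFun_indicatorSection, toFun_indicatorSection]
  by_cases hx : x ∈ (U : Set N)
  · rw [Set.indicator_of_mem hx, Set.indicator_of_mem hx, Set.indicator_of_mem hx]
  · rw [Set.indicator_of_notMem hx, Set.indicator_of_notMem hx, Set.indicator_of_notMem hx, add_zero]

/-- The indicator section is homogeneous in `w`. [cite: BernsteinZelevinsky1976, §1.1–§1.3] -/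
theorem indicatorSection_smul (U : Subgroup N) (hU : IsOpen (U : Set N)) (c : k) (w : W) :
    indicatorSection (k := k) U hU (c • w) = c • indicatorSection U hU w := by
  apply SmoothInd.ext
  funext x
  rw [SmoothInd.toFun_smul, Pi.smul_apply, toFun_indicatorSection, toFun_indicatorSection]
  by_cases hx : x ∈ (U : Set N)
  · rw [Set.indicator_of_mem hx, Set.indicator_of_mem hx]
  · rw [Set.indicator_of_notMem hx, Set.indicator_of_notMem hx, smul_zero]

/-- A compact open subgroup's indicator section is compactly supported (lies in `S(N) ⊗ W`). [cite: BernsteinZelevinsky1976, §1.1–§1.3] -/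
theorem indicatorSection_mem_compactlySupported (U : Subgroup N) (hU : IsOpen (U : Set N))
    (hUc : IsCompact (U : Set N)) (w : W) :
    indicatorSection (k := k) U hU w ∈ compactlySupported k N W :=
  ⟨U, hUc, fun _ hx => toFun_indicatorSection_of_notMem U hU w hx⟩

/-- **Right translates of indicator sections**: `(g · 1_U ⊗ w)(x) = 1_U(x g) w`. [cite: BernsteinZelevinsky1976, §1.18] -/
theorem toFun_smoothIndRep_indicatorSection (U : Subgroup N) (hU : IsOpen (U : Set N)) (w : W) (g x : N) :
    (smoothIndRep (⊥ : Subgroup N) (Representation.trivial k (⊥ : Subgroup N) W) g (indicatorSection U hU w)).toFun x =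
      (U : Set N).indicator (fun _ => w) (x * g) := by
  rw [toFun_smoothIndRep_apply, toFun_indicatorSection]

/-- **The indicator of a left coset is a right translate of the indicator of the conjugate subgroup**:
`1_{yS} ⊗ w = y⁻¹ · (1_{ySy⁻¹} ⊗ w)`, i.e. `(y⁻¹ · 1_{ySy⁻¹} ⊗ w)(x) = 1_S(y⁻¹ x) w`. [cite: BernsteinZelevinsky1976, §1.18] -/
theorem toFun_smoothIndRep_inv_indicatorSection_conj (S : Subgroup N) (y : N)
    (hyS : IsOpen ((MulAut.conj y • S : Subgroup N) : Set N)) (w : W) (x : N) :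
    (smoothIndRep (⊥ : Subgroup N) (Representation.trivial k (⊥ : Subgroup N) W) y⁻¹
        (indicatorSection (MulAut.conj y • S) hyS w)).toFun x = (S : Set N).indicator (fun _ => w) (y⁻¹ * x) := by
  rw [toFun_smoothIndRep_indicatorSection]
  have hiff : x * y⁻¹ ∈ ((MulAut.conj y • S : Subgroup N) : Set N) ↔ y⁻¹ * x ∈ (S : Set N) := by
    rw [SetLike.mem_coe, SetLike.mem_coe, Subgroup.mem_smul_pointwise_iff_exists]
    constructor
    · rintro ⟨s, hs, hxs⟩
      rw [MulAut.smul_def, MulAut.conj_apply] at hxs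
      have hx : y * s = x := by
        have := congrArg (· * y) hxs
        simpa using this
      rw [← hx, inv_mul_cancel_left]
      exact hs
    · intro h
      exact ⟨y⁻¹ * x, h, by rw [MulAut.smul_def, MulAut.conj_apply]; group⟩
  by_cases hx : y⁻¹ * x ∈ (S : Set N)
  · rw [Set.indicator_of_mem (hiff.2 hx), Set.indicator_of_mem hx]
  · rw [Set.indicator_of_notMem (fun h => hx (hiff.1 h)), Set.indicator_of_notMem hx]

omit [TopologicalSpace N] [IsTopologicalGroup N] in
/-- The underlying set of the conjugate subgroup `y S y⁻¹` is the image of `S` under `s ↦ y s y⁻¹`. [cite: BernsteinZelevinsky1976, §1.1–§1.3] -/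
theorem coe_conj_smul_eq_image (S : Subgroup N) (y : N) :
    ((MulAut.conj y • S : Subgroup N) : Set N) = (fun s => y * s * y⁻¹) '' (S : Set N) := by
  rw [Subgroup.coe_pointwise_smul]
  ext x
  simp only [Set.mem_smul_set, MulAut.smul_def, MulAut.conj_apply, Set.mem_image, SetLike.mem_coe]

/-- Conjugates of an open subgroup are open. [cite: BernsteinZelevinsky1976, §1.1–§1.3] -/
theorem isOpen_conj_smul (S : Subgroup N) (hS : IsOpen (S : Set N)) (y : N) :
    IsOpen ((MulAut.conj y • S : Subgroup N) : Set N) := by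
  rw [coe_conj_smul_eq_image, show (fun s : N => y * s * y⁻¹) = (Homeomorph.mulRight y⁻¹) ∘ (Homeomorph.mulLeft y) from
    funext fun s => rfl, Set.image_comp]
  exact (Homeomorph.mulRight y⁻¹).isOpenMap _ ((Homeomorph.mulLeft y).isOpenMap _ hS)

/-- Conjugates of a compact subgroup are compact. [cite: BernsteinZelevinsky1976, §1.1–§1.3] -/
theorem isCompact_conj_smul (S : Subgroup N) (hS : IsCompact (S : Set N)) (y : N) :
    IsCompact ((MulAut.conj y • S : Subgroup N) : Set N) := by
  rw [coe_conj_smul_eq_image]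
  exact hS.image ((continuous_const.mul continuous_id).mul continuous_const)

/-! ## §3 Sums over transversals: `[1_U ⊗ w] = [U : V] • [1_V ⊗ w]` -/

/-- `toFun` of a finite sum of smooth functions (pointwise). [cite: BernsteinZelevinsky1976, §1.1–§1.3] -/
theorem SmoothInd.toFun_finset_sum {ι : Type*} (s : Finset ι)
    (F : ι → SmoothInd (⊥ : Subgroup N) (Representation.trivial k (⊥ : Subgroup N) W)) (x : N) :
    (∑ i ∈ s, F i).toFun x = ∑ i ∈ s, (F i).toFun x := by
  classical
  induction s using Finset.induction_on with
  | empty =>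
    rw [Finset.sum_empty, Finset.sum_empty]
    have h := SmoothInd.toFun_smul (H := (⊥ : Subgroup N)) (σ := Representation.trivial k _ W) (0 : k) 0
    rw [zero_smul, zero_smul] at h
    rw [h, Pi.zero_apply]
  | insert a s ha ih => rw [Finset.sum_insert ha, Finset.sum_insert ha, SmoothInd.toFun_add, Pi.add_apply, ih]

/-- **Tiling `U` by the right cosets `V r⁻¹` of a left transversal**: for an open subgroup `V ≤ U` and a left transversal
`R` of `U ∕ V`, `1_U ⊗ w = ∑_{r ∈ R} r · (1_V ⊗ w)` (`(r · 1_V)(x) = 1_V(x r)`, and `x r ∈ V` for exactly one `r ∈ R` when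
`x ∈ U`, for none when `x ∉ U`). [cite: BernsteinZelevinsky1976, §1.18] -/
theorem indicatorSection_eq_sum_transversal {U V : Subgroup N} (hU : IsOpen (U : Set N)) (hV : IsOpen (V : Set N))
    (hVU : V ≤ U) {R : Finset N} (hR : IsLeftTransversal U V R) (w : W) :
    indicatorSection (k := k) U hU w =
      ∑ r ∈ R, smoothIndRep (⊥ : Subgroup N) (Representation.trivial k (⊥ : Subgroup N) W) r (indicatorSection V hV w) := by
  apply SmoothInd.ext
  funext x
  rw [SmoothInd.toFun_finset_sum, toFun_indicatorSection]
  simp only [toFun_smoothIndRep_indicatorSection]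
  by_cases hx : x ∈ U
  · -- exactly one `r ∈ R` with `x r ∈ V`
    obtain ⟨r₀, ⟨hr₀R, hr₀⟩, huniq⟩ := hR.existsUnique x⁻¹ (U.inv_mem hx)
    have hxr₀ : x * r₀ ∈ V := by
      have := V.inv_mem hr₀
      rwa [mul_inv_rev, inv_inv, inv_inv] at this
    rw [Set.indicator_of_mem (show x ∈ (U : Set N) from hx), Finset.sum_eq_single r₀]
    · rw [Set.indicator_of_mem (show x * r₀ ∈ (V : Set N) from hxr₀)]
    · intro r hrR hne
      rw [Set.indicator_of_notMem]
      intro hxr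
      apply hne
      exact huniq r ⟨hrR, by
        have := V.inv_mem hxr
        rwa [mul_inv_rev] at this⟩
    · intro h
      exact absurd hr₀R h
  · rw [Set.indicator_of_notMem (show x ∉ (U : Set N) from hx)]
    refine (Finset.sum_eq_zero fun r hr => ?_).symm
    rw [Set.indicator_of_notMem]
    intro hxr
    exact hx (by simpa using U.mul_mem (hVU hxr) (U.inv_mem (hR.mem_of_mem r hr)))

/-- The action of `N` on `C_c^∞(N, W)` is the restriction of right translation (coercion lemma). [cite: BernsteinZelevinsky1976, §2.22] -/
theorem coe_compactlySupported_apply (g : N) (φ : ↥(compactlySupported k N W).toSubmodule) :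
    (((compactlySupported k N W).toRepresentation g φ : ↥(compactlySupported k N W).toSubmodule) :
        SmoothInd (⊥ : Subgroup N) (Representation.trivial k (⊥ : Subgroup N) W)) =
      smoothIndRep (⊥ : Subgroup N) (Representation.trivial k (⊥ : Subgroup N) W) g φ :=
  rfl

/-- **`[1_U ⊗ w] = |R| • [1_V ⊗ w]`** in the coinvariants of `C_c^∞(N, W)`, for `V ≤ U` compact open subgroups and `R` a left
transversal of `U ∕ V` (each `[r · 1_V ⊗ w] = [1_V ⊗ w]`). [cite: BernsteinZelevinsky1976, §1.18–§1.19] -/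
theorem mk_indicatorSection_eq_card_smul {U V : Subgroup N} (hU : IsOpen (U : Set N)) (hUc : IsCompact (U : Set N))
    (hV : IsOpen (V : Set N)) (hVc : IsCompact (V : Set N)) (hVU : V ≤ U) {R : Finset N} (hR : IsLeftTransversal U V R)
    (w : W) :
    Coinvariants.mk (compactlySupported k N W).toRepresentation
        ⟨indicatorSection U hU w, indicatorSection_mem_compactlySupported U hU hUc w⟩ =
      R.card • Coinvariants.mk (compactlySupported k N W).toRepresentation
        ⟨indicatorSection V hV w, indicatorSection_mem_compactlySupported V hV hVc w⟩ := by
  have hsum : (⟨indicatorSection U hU w, indicatorSection_mem_compactlySupported U hU hUc w⟩ :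
      ↥(compactlySupported k N W).toSubmodule) =
      ∑ r ∈ R, (compactlySupported k N W).toRepresentation r
        ⟨indicatorSection V hV w, indicatorSection_mem_compactlySupported V hV hVc w⟩ := by
    apply Subtype.ext
    rw [Submodule.coe_sum]
    exact indicatorSection_eq_sum_transversal hU hV hVU hR w
  rw [hsum, map_sum]
  simp only [Coinvariants.mk_self_apply]
  rw [Finset.sum_const]

/-- The map `w ↦ [1_{K₀} ⊗ w]`, `W →ₗ C_c^∞(N, W)_N`. [cite: BernsteinZelevinsky1976, §1.18–§1.19] -/
def indicatorClassMap (K₀ : Subgroup N) (hK₀ : IsOpen (K₀ : Set N)) (hK₀c : IsCompact (K₀ : Set N)) :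
    W →ₗ[k] (compactlySupported k N W).toRepresentation.Coinvariants where
  toFun w := Coinvariants.mk (compactlySupported k N W).toRepresentation
    ⟨indicatorSection K₀ hK₀ w, indicatorSection_mem_compactlySupported K₀ hK₀ hK₀c w⟩
  map_add' w w' := by
    rw [← map_add]
    congr 1
    exact Subtype.ext (indicatorSection_add K₀ hK₀ w w')
  map_smul' c w := by
    rw [RingHom.id_apply, ← map_smul]
    congr 1
    exact Subtype.ext (indicatorSection_smul K₀ hK₀ c w)

/-- Unfolding of `indicatorClassMap`: `w ↦ [1_{K₀} ⊗ w]`. [cite: BernsteinZelevinsky1976, §1.18–§1.19] -/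
theorem indicatorClassMap_apply (K₀ : Subgroup N) (hK₀ : IsOpen (K₀ : Set N)) (hK₀c : IsCompact (K₀ : Set N)) (w : W) :
    indicatorClassMap (k := k) K₀ hK₀ hK₀c w = Coinvariants.mk (compactlySupported k N W).toRepresentation
      ⟨indicatorSection K₀ hK₀ w, indicatorSection_mem_compactlySupported K₀ hK₀ hK₀c w⟩ :=
  rfl

variable [CharZero k]

/-- **Every `[1_U ⊗ w]` is a `[1_{K₀} ⊗ w′]`**: with `V := U ∩ K₀` and transversals `R₁` of `U ∕ V`, `R₂` of `K₀ ∕ V`,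
`[1_U ⊗ w] = |R₁| • [1_V ⊗ w]` and `[1_{K₀} ⊗ w] = |R₂| • [1_V ⊗ w]`, so `[1_U ⊗ w] = [1_{K₀} ⊗ (|R₁| |R₂|⁻¹) w]`
(characteristic `0`: `|R₂| ≠ 0`). [cite: BernsteinZelevinsky1976, §1.18–§1.19] -/
theorem mk_indicatorSection_mem_range (K₀ : Subgroup N) (hK₀ : IsOpen (K₀ : Set N)) (hK₀c : IsCompact (K₀ : Set N))
    (U : Subgroup N) (hU : IsOpen (U : Set N)) (hUc : IsCompact (U : Set N)) (w : W) :
    Coinvariants.mk (compactlySupported k N W).toRepresentation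
        ⟨indicatorSection U hU w, indicatorSection_mem_compactlySupported U hU hUc w⟩ ∈
      LinearMap.range (indicatorClassMap (k := k) K₀ hK₀ hK₀c) := by
  -- `V := U ∩ K₀`, transversals of `U / V` and `K₀ / V`
  have hVo : IsOpen ((U ⊓ K₀ : Subgroup N) : Set N) := hU.inter hK₀
  have hVc : IsCompact ((U ⊓ K₀ : Subgroup N) : Set N) :=
    hUc.of_isClosed_subset (Subgroup.isClosed_of_isOpen _ hVo) (fun x hx => hx.1)
  obtain ⟨R₁, hR₁⟩ := exists_isLeftTransversal (B := U) (T := K₀) hUc hK₀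
  obtain ⟨R₂, hR₂⟩ := exists_isLeftTransversal (B := K₀) (T := U) hK₀c hU
  rw [show K₀ ⊓ U = U ⊓ K₀ from inf_comm _ _] at hR₂
  have h1 := mk_indicatorSection_eq_card_smul (k := k) hU hUc hVo hVc inf_le_left hR₁ w
  have h2 := mk_indicatorSection_eq_card_smul (k := k) hK₀ hK₀c hVo hVc inf_le_right hR₂ w
  have hR₂0 : (R₂.card : k) ≠ 0 := Nat.cast_ne_zero.2 (Finset.card_pos.2 hR₂.nonempty).ne'
  refine ⟨((R₁.card : k) * (R₂.card : k)⁻¹) • w, ?_⟩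
  rw [map_smul, indicatorClassMap_apply, h2, h1, ← Nat.cast_smul_eq_nsmul k, ← Nat.cast_smul_eq_nsmul k, smul_smul,
    mul_assoc, inv_mul_cancel₀ hR₂0, mul_one]

/-! ## §4 Every class is an indicator class: `C_c^∞(N, W)_N` is a quotient of `W` -/

omit [CharZero k] in
/-- **Decomposition of a compactly supported smooth function along the left cosets of a small compact open subgroup**:
for `φ ∈ C_c^∞(N, W)` and a compact open `K₀`, with `S := K₀ ∩ Stab(φ)` there is a finite set `T` of left cosets of `S`
such that `φ = ∑_{q ∈ T} q̃⁻¹ · (1_{q̃ S q̃⁻¹} ⊗ φ(q̃))` (`q̃ = q.out`), i.e. `φ = ∑ 1_{q̃ S} ⊗ φ(q̃)`.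
[cite: BernsteinZelevinsky1976, §1.18–§1.19] -/
theorem exists_eq_sum_indicatorSection_conj (K₀ : Subgroup N) (hK₀ : IsOpen (K₀ : Set N)) (hK₀c : IsCompact (K₀ : Set N))
    (φ : SmoothInd (⊥ : Subgroup N) (Representation.trivial k (⊥ : Subgroup N) W)) (hφ : φ ∈ compactlySupported k N W) :
    ∃ (S : Subgroup N) (hSo : IsOpen (S : Set N)), IsCompact (S : Set N) ∧ ∃ T : Finset (N ⧸ S),
      φ = ∑ q ∈ T, smoothIndRep (⊥ : Subgroup N) (Representation.trivial k (⊥ : Subgroup N) W) (q.out)⁻¹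
        (indicatorSection (MulAut.conj q.out • S) (isOpen_conj_smul S hSo q.out) (φ.toFun q.out)) := by
  classical
  -- `S := K₀ ∩ Stab(φ)`
  let S : Subgroup N := K₀ ⊓ (smoothIndRep (⊥ : Subgroup N) (Representation.trivial k (⊥ : Subgroup N) W)).stabilizerSubgroup φ
  have hSo : IsOpen (S : Set N) := hK₀.inter (isSmooth_smoothInd (⊥ : Subgroup N) _ φ)
  have hSc : IsCompact (S : Set N) := hK₀c.of_isClosed_subset (Subgroup.isClosed_of_isOpen _ hSo) (fun x hx => hx.1)
  obtain ⟨C, hC, hφC⟩ := hφ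
  -- finitely many left cosets `y S`, `y ∈ C`, cover `C`
  let U : N → Set N := fun y => {x | y⁻¹ * x ∈ S}
  have hUo : ∀ y ∈ C, IsOpen (U y) := fun y _ => hSo.preimage (continuous_const.mul continuous_id)
  have hcover : C ⊆ ⋃ y ∈ C, U y := fun y hy => Set.mem_iUnion₂.2 ⟨y, hy, by simp [U, S.one_mem]⟩
  obtain ⟨Y, hYC, hYfin, hYcover⟩ := hC.elim_finite_subcover_image hUo hcover
  refine ⟨S, hSo, hSc, hYfin.toFinset.image (QuotientGroup.mk : N → N ⧸ S), ?_⟩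
  apply SmoothInd.ext
  funext x
  rw [SmoothInd.toFun_finset_sum]
  simp only [toFun_smoothIndRep_inv_indicatorSection_conj]
  -- `q.out⁻¹ x ∈ S ↔ q = mk x`
  have hkey : ∀ q : N ⧸ S, (q.out⁻¹ * x ∈ (S : Set N)) ↔ q = QuotientGroup.mk x := fun q => by
    rw [SetLike.mem_coe, ← QuotientGroup.eq, QuotientGroup.out_eq']
  by_cases hx : ∃ y ∈ Y, y⁻¹ * x ∈ S
  · obtain ⟨y, hyY, hyx⟩ := hx
    have hmem : (QuotientGroup.mk x : N ⧸ S) ∈ hYfin.toFinset.image (QuotientGroup.mk : N → N ⧸ S) :=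
      Finset.mem_image.2 ⟨y, hYfin.mem_toFinset.2 hyY, QuotientGroup.eq.2 hyx⟩
    rw [Finset.sum_eq_single (QuotientGroup.mk x : N ⧸ S)]
    · rw [Set.indicator_of_mem ((hkey _).2 rfl)]
      -- `x = q̃ s` with `s ∈ S ≤ Stab(φ)`
      have hs : ((QuotientGroup.mk x : N ⧸ S).out)⁻¹ * x ∈ S := (hkey _).2 rfl
      have hxeq : x = (QuotientGroup.mk x : N ⧸ S).out * (((QuotientGroup.mk x : N ⧸ S).out)⁻¹ * x) := by group
      conv_lhs => rw [hxeq]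
      exact SmoothInd.toFun_mul_of_mem_stabilizer hs.2 _
    · intro q _ hq
      rw [Set.indicator_of_notMem (fun h => hq ((hkey q).1 h))]
    · intro h
      exact absurd hmem h
  · -- off the cover: both sides vanish
    have hxC : x ∉ C := fun hxC => by
      obtain ⟨y, hyY, hy⟩ := Set.mem_iUnion₂.1 (hYcover hxC)
      exact hx ⟨y, hyY, hy⟩
    rw [hφC x hxC]
    refine (Finset.sum_eq_zero fun q hq => ?_).symm
    rw [Set.indicator_of_notMem]
    intro hqx
    obtain ⟨y, hyY, hyq⟩ := Finset.mem_image.1 hq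
    apply hx
    refine ⟨y, hYfin.mem_toFinset.1 hyY, ?_⟩
    have h1 : (QuotientGroup.mk y : N ⧸ S) = QuotientGroup.mk x := hyq.trans ((hkey q).1 hqx)
    exact QuotientGroup.eq.1 h1

/-- **Every class of `C_c^∞(N, W)_N` is the class of an indicator section `1_{K₀} ⊗ w`** (any fixed compact open subgroup
`K₀`; characteristic `0`). [cite: BernsteinZelevinsky1976, §1.18–§1.19] [cite: BernsteinZelevinsky1977, Proposition 1.9 (a)] -/
theorem exists_eq_indicatorClassMap (K₀ : Subgroup N) (hK₀ : IsOpen (K₀ : Set N)) (hK₀c : IsCompact (K₀ : Set N))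
    (x : (compactlySupported k N W).toRepresentation.Coinvariants) :
    ∃ w : W, x = indicatorClassMap (k := k) K₀ hK₀ hK₀c w := by
  obtain ⟨⟨φ, hφ⟩, rfl⟩ := Coinvariants.mk_surjective _ x
  obtain ⟨S, hSo, hSc, T, hφT⟩ := exists_eq_sum_indicatorSection_conj (k := k) K₀ hK₀ hK₀c φ hφ
  have hsum : (⟨φ, hφ⟩ : ↥(compactlySupported k N W).toSubmodule) =
      ∑ q ∈ T, (compactlySupported k N W).toRepresentation (q.out)⁻¹
        ⟨indicatorSection (MulAut.conj q.out • S) (isOpen_conj_smul S hSo q.out) (φ.toFun q.out),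
          indicatorSection_mem_compactlySupported _ _ (isCompact_conj_smul S hSc q.out) _⟩ := by
    apply Subtype.ext
    rw [Submodule.coe_sum]
    exact hφT
  have hmem : Coinvariants.mk (compactlySupported k N W).toRepresentation ⟨φ, hφ⟩ ∈
      LinearMap.range (indicatorClassMap (k := k) K₀ hK₀ hK₀c) := by
    rw [hsum, map_sum]
    refine Submodule.sum_mem _ fun q _ => ?_
    rw [Coinvariants.mk_self_apply]
    exact mk_indicatorSection_mem_range K₀ hK₀ hK₀c _ _ (isCompact_conj_smul S hSc q.out) _
  obtain ⟨w, hw⟩ := hmem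
  exact ⟨w, hw.symm⟩

/-- **`dim H₀(N, C_c^∞(N, W)) ≤ dim W`**: for a topological group `N` which is the union of its compact open subgroups
(★ `IsLimitOfCompactOpen`) and a finite-dimensional `W` over a field of characteristic `0`, the `N`-coinvariants of
`C_c^∞(N, W)` under right translation are finite-dimensional of dimension at most `dim W` (equality holds — the Haar integral —
but is not needed for upper bounds in the geometric lemma). [cite: BernsteinZelevinsky1976, §1.18–§1.19]
[cite: BernsteinZelevinsky1977, Proposition 1.9 (a)] -/
theorem finrank_coinvariants_compactlySupported_le [FiniteDimensional k W] (hN : IsLimitOfCompactOpen N) :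
    FiniteDimensional k (compactlySupported k N W).toRepresentation.Coinvariants ∧
      Module.finrank k (compactlySupported k N W).toRepresentation.Coinvariants ≤ Module.finrank k W := by
  obtain ⟨K₀, hK₀, hK₀c, -⟩ := hN {1} isCompact_singleton
  have hsurj : Function.Surjective (indicatorClassMap (k := k) (W := W) K₀ hK₀ hK₀c) := fun x => by
    obtain ⟨w, rfl⟩ := exists_eq_indicatorClassMap (k := k) K₀ hK₀ hK₀c x
    exact ⟨w, rfl⟩
  haveI : FiniteDimensional k (compactlySupported k N W).toRepresentation.Coinvariants := Module.Finite.of_surjective _ hsurj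
  exact ⟨inferInstance, LinearMap.finrank_le_finrank_of_surjective hsurj⟩

end CompactlySupported

end Representation

end
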